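import Literature.InformationTheory.QuantumCodes.SymplecticCodes
import Literature.InformationTheory.QuantumCodes.ParityCheckDuality
import HarnessLib

/-!
# Bravyi–Terhal–Leemhuis: every `[[n,k,d]]` stabilizer code maps to a `[[4n,2k,2d]]` weakly self-dual CSS code (proved)

Source followed: S. Bravyi, B. M. Terhal, B. Leemhuis, *Majorana fermion codes*, New J. Phys. **12**
(2010) 083039 = arXiv:1004.3791 [BravyiTerhalLeemhuis2010], §4 "Definition of Majorana fermion codes"
(held TeX chunk p0007) and §5 "Code mappings" (chunk p0009), read on the page:

> **§4.** «A Majorana fermion code is determined by its stabilizer group `S_maj ⊆ Maj(2n)` which must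
> obey two conditions: • `S_maj` is an Abelian group not containing `−I`. • All elements of `S_maj` have
> even weight. … Given any pair of stabilizer operators proportional to `c_A` and `c_B`, the
> commutativity `c_A c_B = c_B c_A` and the even-weight condition imply that the overlap `|A ∩ B|` must
> be even … Logical operators of a Majorana fermion code `S_maj` are elements of `C(S_maj)` which are not
> in `S_maj`. If `S_maj` is generated by `n − k` independent generators, then `C(S_maj)` is generated by
> `n + k` independent generators … We can define the distance of a Majorana fermion code … as the
> minimum weight of logical operators, `d = min_{C ∈ C(S_maj)∖S_maj} |C|`.»
>
> **Lemma 1 (Kitaev).** Every `[[n,k,d]]` qubit stabilizer code `S` can be mapped onto a Majorana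
> fermion code `S_maj` on `4n` modes encoding `k` logical qubits with distance `2d`.
> *Proof.* With every qubit `j`, we associate four Majorana fermion modes, `b_j^{x,y,z}` and `c_j` …
> we replace the local Pauli operators by `X_j = i b_j^x c_j`, `Y_j = i b_j^y c_j`, `Z_j = i b_j^z c_j`.
> In addition, for each qubit `j` we add a stabilizer `D_j = b_j^x b_j^y b_j^z c_j` … Thus `S_maj` is
> generated by `2n − k` independent generators … since a logical operator of the Majorana fermion code
> has to commute with each `D_j`, it must contain an even number of the set `{b_j^x, b_j^y, b_j^z, c_j}`,
> and therefore it corresponds to a logical operator of `S`. Since every Pauli operator corresponds to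
> a weight-2 Majorana operator, the distance of the Majorana fermion code is twice the distance of the
> stabilizer code. □
>
> **Lemma 2 (Doubling).** With every Majorana fermion code `S_maj` on `2n` Majorana modes which encodes
> `k` logical qubits and has distance `d`, we can associate a `[[2n,2k,d]]` weakly self-dual CSS code.
> *Proof.* … Consider a classical code `C = φ(S_maj) ⊂ {0,1}^{2n}`. Note that `dim(C) = n − k` … the
> supports of any elements `P, Q ∈ S_maj` must have even overlap. Hence … `C ⊆ C⊥`. Let
> `S = S(X)·S(Z)` be the weakly self-dual CSS code constructed from `C` … `2n` qubits, `n − k`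
> independent generators of `X`-type, and `n − k` independent generators of `Z`-type. Hence `S` encodes
> `2k` qubits. … Hence the distances of these codes are identical. □
>
> **Corollary 1.** Any `[[n,k,d]]` stabilizer code can be mapped onto a `[[4n,2k,2d]]` weakly
> self-dual CSS code. This mapping preserves geometric locality of a code up to a constant factor.

What is PROVED here, in the binary language of `SymplecticCodes.lean` (`SympVec n = 𝔽₂ⁿ × 𝔽₂ⁿ`,
`[[n,k,d]]` = `IsAdditiveCode`, CSS stabilizer space `cssSpace C₁ C₂ = C₁ × C₂⊥`, classical dual
`Coding.dualCode`). A Majorana operator `c_A` is recorded (phases dropped, exactly as Paulis are recorded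
by `(a|b)`) by the indicator vector of its support `A`, so that products become sums, `|A ∩ B| mod 2`
becomes the dot product, and "even weight" becomes `u ⬝ᵥ u = 0` (`dotProduct_self_eq_zero_iff_even`):

* `IsMajoranaCode C k d` — the binary content of BTL's definition for a subspace `C ≤ 𝔽₂^m` of
  supports: `C ⊆ C⊥` (abelian with all elements even), `2·(dim C + k) = m` (`n − k` generators on
  `m = 2n` modes), and every word of `C⊥ ∖ C` (logical operator) has weight `≥ d`;
* **`BravyiTerhalLeemhuis2010_lemma2`** — Lemma 2: `IsMajoranaCode C k d`, `k ≥ 1` ⟹ the weakly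
  self-dual CSS space `cssSpace C C⊥ = C × C` is an `[[m, 2k, d]]` additive code
  (`finrank_cssSpace_dualCode`, `hasMinDist_cssSpace_dualCode_iff` give the exact count and distance);
  BTL's illustration `S_maj = ⟨c₁c₂c₃c₄⟩ ↦ [[4,2,2]] = ⟨XXXX, ZZZZ⟩` is `isMajoranaCode_fourModes` /
  `isAdditiveCode_doubled_fourModes`;
* the Lemma-1 map: `btlLift` (block `j` of `(a|b)` is `(a_j, 0, b_j, a_j + b_j)` on the modes
  `(b_j^x, b_j^y, b_j^z, c_j)` — the supports of `X_j = i b^x c`, `Z_j = i b^z c`, and of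
  `X_j Z_j ∝ Y_j D_j`), the gauge words `btlGauge j = D_j = 1111` on block `j`,
  `btlCode S = btlLift(S) + ⟨D_1, …, D_n⟩ = φ(S_maj)`, the block parities `btlParity` (`u ↦ (u·D_j)_j`)
  and the projection `btlProj` back to Paulis; the identities `btlLift s ⬝ᵥ btlLift t = ⟨s,t⟩_symp`,
  `u ⬝ᵥ btlLift t = ⟨btlProj u, t⟩ + Σ_j parity_j(u)(a_j + b_j)`, `D_j ⬝ᵥ u = parity_j(u)`; hence
  `mem_btlCode_iff` / `mem_dualCode_btlCode_iff` ("a logical operator has to commute with each `D_j`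
  … and therefore corresponds to a logical operator of `S`"), `finrank_btlCode = dim S + n`
  (`2n − k` generators), `hammingNorm_btlLift = 2·wt` and `two_mul_sympWeight_btlProj_le` ("every
  Pauli operator corresponds to a weight-2 Majorana operator");
* **`BravyiTerhalLeemhuis2010_lemma1`** — Lemma 1: `IsAdditiveCode S k d → IsMajoranaCode (btlCode S) k (2d)`
  on `4n` modes; `hasMinDist_btl_iff` — the distance is EXACTLY doubled;
* **`BravyiTerhalLeemhuis2010_corollary1`** — Corollary 1: for an `[[n,k,d]]` additive code `S` with
  `k ≥ 1`, `cssSpace (btlCode S) (btlCode S)⊥` is a `[[4n, 2k, 2d]]` additive code; existence form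
  `AdditiveCodeExists n k d → AdditiveCodeExists (4n) (2k) (2d)` (`BravyiTerhalLeemhuis2010_corollary1_exists`).

Scope notes. (i) `k ≥ 1`: for `k = 0` BTL's distance (a minimum over the empty set of logical
operators) is vacuous, while the tree's `IsAdditiveCode _ 0 d` uses the CRSS convention (all nonzero
stabilizer words have weight `≥ d`), which the weight-4 words `(D_j | 0)` violate for `2d > 4`; so the
`k = 0` case is not asserted. (ii) The locality clause of Corollary 1 is not formalized (the tree has no
geometry on qubit positions); the map is visibly block-local: qubit `j` ↦ modes/qubits `4j, …, 4j+3`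
(`finProdFinEquiv (j, t) = 4j + t`). (iii) The resulting CSS code is in general NOT pure (it contains the
weight-4 words `(D_j|0)`), and BTL do not claim purity.

No named facts; axioms standard. `lean search` (2026-08-27): no Majorana-code or stabilizer→CSS
doubling notion in the tree (`MinimumDistanceHardness.lean` only mentions the map in a docstring).
-/

namespace Literature.InformationTheory.QuantumCodes

open Matrix Module Coding Finset

/-! ### Arithmetic in `𝔽₂` used below (kernel-decided truth tables) -/

/-- `x + x = 0` in `𝔽₂`. [folklore] -/
private theorem zmod2_add_self : ∀ x : ZMod 2, x + x = 0 := by decide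

/-- `x² = x` in `𝔽₂`. [folklore] -/
private theorem zmod2_mul_self : ∀ x : ZMod 2, x * x = x := by decide

/-- The indicator of `x ≠ 0`, read in `𝔽₂`, is `x`. [folklore] -/
private theorem zmod2_cast_ite : ∀ x : ZMod 2, ((if x ≠ 0 then 1 else 0 : ℕ) : ZMod 2) = x := by decide

/-! ### Even weight = self-orthogonality over `𝔽₂` -/

/-- Over `𝔽₂`, `u ⬝ᵥ u = |supp u| mod 2`; so "`c_A` has even weight" is `u ⬝ᵥ u = 0` for the support
vector `u` of `A`, and a subspace `C ⊆ C⊥` consists of even words with pairwise even overlaps — the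
two conditions of BTL's definition («All elements of `S_maj` have even weight … the overlap `|A ∩ B|`
must be even»). [cite: BravyiTerhalLeemhuis2010, §4 (arXiv:1004.3791 chunk p0007 L52–60)] -/
theorem dotProduct_self_eq_zero_iff_even {m : ℕ} (u : Fin m → ZMod 2) :
    u ⬝ᵥ u = 0 ↔ Even (hammingNorm u) := by
  have h1 : u ⬝ᵥ u = ∑ i, u i :=
    Finset.sum_congr rfl fun i _ => zmod2_mul_self (u i)
  have h2 : ((hammingNorm u : ℕ) : ZMod 2) = ∑ i, u i := by
    simp only [hammingNorm, Finset.card_filter, Nat.cast_sum]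
    exact Finset.sum_congr rfl fun i _ => zmod2_cast_ite (u i)
  rw [h1, ← h2, ZMod.natCast_eq_zero_iff_even]

/-! ### Binary Majorana fermion codes; weakly self-dual CSS codes; Lemma 2 (doubling) -/

section Majorana

variable {m : ℕ}

/-- **Majorana fermion code, binary form.** A subspace `C ≤ 𝔽₂^m` of supports (the image `φ(S_maj)`
of a Majorana stabilizer group on `m` modes, phases dropped) is a Majorana fermion code encoding `k`
logical qubits with distance (at least) `d` when: `C ⊆ C⊥` (the group is abelian and all its
elements are even — over `𝔽₂` both are dot-product conditions, `dotProduct_self_eq_zero_iff_even`);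
`2(dim C + k) = m` («generated by `n − k` independent generators» on `m = 2n` modes); and every
element of `C⊥ ∖ C` (a logical operator: «elements of `C(S_maj)` which are not in `S_maj`», the
centralizer of an even group being the words with even overlap with all of `C`) has weight `≥ d`
(«the distance … the minimum weight of logical operators»). As for `IsAdditiveCode`, `d` is recorded
as a lower bound.
[cite: BravyiTerhalLeemhuis2010, §4 (arXiv:1004.3791 chunk p0007 L52–69, L93–95)] -/
def IsMajoranaCode (C : Submodule (ZMod 2) (Fin m → ZMod 2)) (k d : ℕ) : Prop :=
  C ≤ dualCode C ∧ 2 * (finrank (ZMod 2) C + k) = m ∧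
    ∀ u ∈ dualCode C, u ∉ C → d ≤ hammingNorm u

/-- All elements of a Majorana fermion code have even weight (the binary reading of BTL's second
condition). [cite: BravyiTerhalLeemhuis2010, §4 (arXiv:1004.3791 chunk p0007 L55)] -/
theorem IsMajoranaCode.even_hammingNorm {C : Submodule (ZMod 2) (Fin m → ZMod 2)} {k d : ℕ}
    (h : IsMajoranaCode C k d) {u : Fin m → ZMod 2} (hu : u ∈ C) : Even (hammingNorm u) :=
  (dotProduct_self_eq_zero_iff_even u).1 (mem_dualCode_iff.1 (h.1 hu) u hu)

/-- Any two elements of a Majorana fermion code have even overlap (`u ⬝ᵥ v = 0`: the group is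
abelian). [cite: BravyiTerhalLeemhuis2010, §4 (arXiv:1004.3791 chunk p0007 L59–60)] -/
theorem IsMajoranaCode.dotProduct_eq_zero {C : Submodule (ZMod 2) (Fin m → ZMod 2)} {k d : ℕ}
    (h : IsMajoranaCode C k d) {u v : Fin m → ZMod 2} (hu : u ∈ C) (hv : v ∈ C) : u ⬝ᵥ v = 0 :=
  mem_dualCode_iff.1 (h.1 hv) u hu

/-- The weakly self-dual CSS space of `C` is `C × C`: `X`-type words from `C` and `Z`-type words from
`(C⊥)⊥ = C` («the special subclass of CSS codes obeying `C_X = C_Z` are called weakly self-dual CSS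
codes»). [cite: BravyiTerhalLeemhuis2010, §3 (arXiv:1004.3791 chunk p0006 L66–68)] -/
theorem mem_cssSpace_dualCode_iff (C : Submodule (ZMod 2) (Fin m → ZMod 2)) {v : SympVec m} :
    v ∈ cssSpace C (dualCode C) ↔ v.1 ∈ C ∧ v.2 ∈ C := by
  rw [mem_cssSpace_iff, dualCode_dualCode]

/-- The symplectic dual (normaliser) of the weakly self-dual CSS space of `C` is `C⊥ × C⊥`.
[cite: BravyiTerhalLeemhuis2010, §5 Lemma 2, proof (arXiv:1004.3791 chunk p0009 L64–70)] -/
theorem sympDual_cssSpace_dualCode (C : Submodule (ZMod 2) (Fin m → ZMod 2)) :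
    sympDual (cssSpace C (dualCode C)) = (dualCode C).prod (dualCode C) :=
  sympDual_cssSpace C (dualCode C)

/-- «`n − k` independent generators of `X`-type, and `n − k` independent generators of `Z`-type»:
`dim (C × C) = 2 dim C`. [cite: BravyiTerhalLeemhuis2010, §5 Lemma 2, proof (arXiv:1004.3791 chunk p0009 L58–61)] -/
theorem finrank_cssSpace_dualCode {C : Submodule (ZMod 2) (Fin m → ZMod 2)} (hC : C ≤ dualCode C) :
    finrank (ZMod 2) (cssSpace C (dualCode C)) = 2 * finrank (ZMod 2) C := by
  have h := (CRSS1998_theorem9_css_holds m C (dualCode C) hC).2.1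
  have hd := finrank_dualCode C
  have hle : finrank (ZMod 2) C ≤ m := by simpa using Submodule.finrank_le C
  rw [Fintype.card_fin] at hd
  omega

/-- The minimum distance of the weakly self-dual CSS code of `C ⊆ C⊥` is the minimum weight of
`C⊥ ∖ C` (both the `X`- and the `Z`-logicals are words of `C⊥ ∖ C`: «w.l.o.g. it is either a product
of `X` or a product of `Z`s»). [cite: BravyiTerhalLeemhuis2010, §5 Lemma 2, proof (arXiv:1004.3791 chunk p0009 L64–70); CalderbankEtAl1998, §5 Thm. 9] -/
theorem hasMinDist_cssSpace_dualCode_iff {C : Submodule (ZMod 2) (Fin m → ZMod 2)}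
    (hC : C ≤ dualCode C) (e : ℕ) :
    HasMinDist (cssSpace C (dualCode C)) e ↔ ∀ u ∈ dualCode C, u ∉ C → e ≤ hammingNorm u := by
  rw [(CRSS1998_theorem9_css_holds m C (dualCode C) hC).2.2 e]
  refine ⟨fun h => h.1, fun h => ⟨h, fun c hc1 hc2 => h c hc1 fun hcC => hc2 ?_⟩⟩
  rw [dualCode_dualCode]
  exact hcC

/-- **BTL Lemma 2 (Doubling), binary form.** A Majorana fermion code `C ≤ 𝔽₂^m` with `k ≥ 1`
logical qubits and distance `d` gives the weakly self-dual CSS code `C × C` on `m` qubits, which is an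
`[[m, 2k, d]]` additive code. (For `k = 0` the tree's `[[m,0,d]]` convention differs from BTL's, see
the module docstring.) [cite: BravyiTerhalLeemhuis2010, §5 Lemma 2 (arXiv:1004.3791 chunk p0009 L20–70)] -/
theorem BravyiTerhalLeemhuis2010_lemma2 {C : Submodule (ZMod 2) (Fin m → ZMod 2)} {k d : ℕ}
    (h : IsMajoranaCode C k d) (hk : 0 < k) :
    IsAdditiveCode (cssSpace C (dualCode C)) (2 * k) d := by
  obtain ⟨hC, hdim, hd⟩ := h
  refine ⟨isSelfOrthogonal_cssSpace hC, ?_, (hasMinDist_cssSpace_dualCode_iff hC d).2 hd,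
    fun h0 => absurd h0 (by omega)⟩
  rw [finrank_cssSpace_dualCode hC]
  omega

/-- A nonzero even word of length `4` has weight `≥ 2`. [folklore] -/
private theorem two_le_hammingNorm_of_even4 : ∀ u : Fin 4 → ZMod 2,
    (fun _ => (1 : ZMod 2)) ⬝ᵥ u = 0 → u ≠ 0 → 2 ≤ hammingNorm u := by
  decide

/-- BTL's illustration of the doubling map: «the simplest Majorana code with `4` Majorana modes and a
single generator `S_maj = ⟨c₁c₂c₃c₄⟩`. Clearly this code has `k = 1` logical qubit … One can easily
check that `S_maj` has distance `d = 2`» — in binary form `C = {0000, 1111} ≤ 𝔽₂⁴`.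
[cite: BravyiTerhalLeemhuis2010, §5 (arXiv:1004.3791 chunk p0009 L23–27)] -/
theorem isMajoranaCode_fourModes :
    IsMajoranaCode (Submodule.span (ZMod 2) {(fun _ => 1 : Fin 4 → ZMod 2)}) 1 2 := by
  have hvv : (fun _ => (1 : ZMod 2) : Fin 4 → ZMod 2) ⬝ᵥ (fun _ => 1) = 0 := by decide
  refine ⟨?_, ?_, fun u hu huC => ?_⟩
  · rw [Submodule.span_le]
    intro x hx
    rw [Set.mem_singleton_iff] at hx
    subst hx
    rw [SetLike.mem_coe, mem_dualCode_iff]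
    intro c hc
    obtain ⟨a, rfl⟩ := Submodule.mem_span_singleton.1 hc
    rw [smul_dotProduct, hvv, smul_zero]
  · rw [finrank_span_singleton (by decide)]
  · have h0 := mem_dualCode_iff.1 hu _ (Submodule.mem_span_singleton_self _)
    exact two_le_hammingNorm_of_even4 u h0 fun h => huC (h ▸ Submodule.zero_mem _)

/-- «The doubled version of `S_maj` is a `[[4,2,2]]` stabilizer code with a stabilizer group
`S = ⟨X₁X₂X₃X₄, Z₁Z₂Z₃Z₄⟩`»: Lemma 2 applied to `isMajoranaCode_fourModes`.
[cite: BravyiTerhalLeemhuis2010, §5 (arXiv:1004.3791 chunk p0009 L28–33)] -/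
theorem isAdditiveCode_doubled_fourModes :
    IsAdditiveCode (cssSpace (Submodule.span (ZMod 2) {(fun _ => 1 : Fin 4 → ZMod 2)})
      (dualCode (Submodule.span (ZMod 2) {(fun _ => 1 : Fin 4 → ZMod 2)}))) 2 2 :=
  BravyiTerhalLeemhuis2010_lemma2 isMajoranaCode_fourModes Nat.one_pos

end Majorana

/-! ### Lemma 1: qubits to Majorana modes, `X_j = i b_j^x c_j`, `Y_j = i b_j^y c_j`, `Z_j = i b_j^z c_j`, `D_j = b_j^x b_j^y b_j^z c_j` -/

section Lemma1

variable {n : ℕ}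

/-- Coefficient of `a_j` on the modes `(b_j^x, b_j^y, b_j^z, c_j)`: the support `{b^x, c}` of `X_j`.
[cite: BravyiTerhalLeemhuis2010, §5 Lemma 1, proof (arXiv:1004.3791 chunk p0009 L12–13)] -/
def btlXCoeff : Fin 4 → ZMod 2 := ![1, 0, 0, 1]

/-- Coefficient of `b_j` on the modes `(b_j^x, b_j^y, b_j^z, c_j)`: the support `{b^z, c}` of `Z_j`.
[cite: BravyiTerhalLeemhuis2010, §5 Lemma 1, proof (arXiv:1004.3791 chunk p0009 L12–13)] -/
def btlZCoeff : Fin 4 → ZMod 2 := ![0, 0, 1, 1]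

/-- Value table of `btlXCoeff` (mode `b^x`). [folklore] -/
@[simp] private theorem btlXCoeff_zero : btlXCoeff 0 = 1 := rfl

/-- Value table of `btlXCoeff` (mode `b^y`). [folklore] -/
@[simp] private theorem btlXCoeff_one : btlXCoeff 1 = 0 := rfl

/-- Value table of `btlXCoeff` (mode `b^z`). [folklore] -/
@[simp] private theorem btlXCoeff_two : btlXCoeff 2 = 0 := rfl

/-- Value table of `btlXCoeff` (mode `c`). [folklore] -/
@[simp] private theorem btlXCoeff_three : btlXCoeff 3 = 1 := rfl

/-- Value table of `btlZCoeff` (mode `b^x`). [folklore] -/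
@[simp] private theorem btlZCoeff_zero : btlZCoeff 0 = 0 := rfl

/-- Value table of `btlZCoeff` (mode `b^y`). [folklore] -/
@[simp] private theorem btlZCoeff_one : btlZCoeff 1 = 0 := rfl

/-- Value table of `btlZCoeff` (mode `b^z`). [folklore] -/
@[simp] private theorem btlZCoeff_two : btlZCoeff 2 = 1 := rfl

/-- Value table of `btlZCoeff` (mode `c`). [folklore] -/
@[simp] private theorem btlZCoeff_three : btlZCoeff 3 = 1 := rfl

/-- **The Lemma-1 map on supports.** The Pauli `(a|b)` (i.e. `∏_j X_j^{a_j} Z_j^{b_j}`) is sent to the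
support vector on the `4n` modes, mode `4j + t` (`t = 0,1,2,3` ↔ `b_j^x, b_j^y, b_j^z, c_j`) carrying
`btlXCoeff t · a_j + btlZCoeff t · b_j`; block `j` is `(a_j, 0, b_j, a_j + b_j)`: `X_j ↦ b^x c`,
`Z_j ↦ b^z c`, `X_j Z_j ↦ b^x b^z`, which is the support of `Y_j = i b^y c` up to the gauge word
`D_j` (so `φ(S_maj) = btlLift(S) + ⟨D_j⟩`, `btlCode`). A linear map.
[cite: BravyiTerhalLeemhuis2010, §5 Lemma 1, proof (arXiv:1004.3791 chunk p0009 L11–14)] -/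
def btlLift (n : ℕ) : SympVec n →ₗ[ZMod 2] (Fin (n * 4) → ZMod 2) :=
  LinearMap.pi fun i =>
    btlXCoeff (finProdFinEquiv.symm i).2 •
        ((LinearMap.proj (finProdFinEquiv.symm i).1).comp (LinearMap.fst _ _ _)) +
      btlZCoeff (finProdFinEquiv.symm i).2 •
        ((LinearMap.proj (finProdFinEquiv.symm i).1).comp (LinearMap.snd _ _ _))

/-- Mode `4j + t` of `btlLift (a|b)` carries `btlXCoeff t · a_j + btlZCoeff t · b_j`.
[cite: BravyiTerhalLeemhuis2010, §5 Lemma 1, proof (arXiv:1004.3791 chunk p0009 L11–14)] -/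
theorem btlLift_apply (s : SympVec n) (j : Fin n) (t : Fin 4) :
    btlLift n s (finProdFinEquiv (j, t)) = btlXCoeff t * s.1 j + btlZCoeff t * s.2 j := by
  simp only [btlLift, LinearMap.pi_apply, LinearMap.add_apply, LinearMap.smul_apply,
    LinearMap.comp_apply, LinearMap.fst_apply, LinearMap.snd_apply, LinearMap.proj_apply,
    Equiv.symm_apply_apply, smul_eq_mul]

/-- **The gauge stabilizer `D_j = b_j^x b_j^y b_j^z c_j`**: the all-ones word on block `j`.
[cite: BravyiTerhalLeemhuis2010, §5 Lemma 1, proof (arXiv:1004.3791 chunk p0009 L13–14)] -/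
def btlGauge (j : Fin n) : Fin (n * 4) → ZMod 2 :=
  fun i => if (finProdFinEquiv.symm i).1 = j then 1 else 0

/-- `D_j` is `1` exactly on the four modes of qubit `j`.
[cite: BravyiTerhalLeemhuis2010, §5 Lemma 1, proof (arXiv:1004.3791 chunk p0009 L13–14)] -/
theorem btlGauge_apply (j j' : Fin n) (t : Fin 4) :
    btlGauge j (finProdFinEquiv (j', t)) = if j' = j then 1 else 0 := by
  simp only [btlGauge, Equiv.symm_apply_apply]

/-- **The Majorana fermion code of Lemma 1** (as a binary code of supports): generated by the images
of the stabilizer words and the `n` gauge words `D_j`, `C = φ(S_maj) = btlLift(S̄) + ⟨D_1,…,D_n⟩`.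
[cite: BravyiTerhalLeemhuis2010, §5 Lemma 1, proof (arXiv:1004.3791 chunk p0009 L11–14)] -/
def btlCode (S : Submodule (ZMod 2) (SympVec n)) : Submodule (ZMod 2) (Fin (n * 4) → ZMod 2) :=
  S.map (btlLift n) ⊔ Submodule.span (ZMod 2) (Set.range (btlGauge (n := n)))

/-- The block parities `u ↦ (Σ_t u_{4j+t})_j = (u ⬝ᵥ D_j)_j`: a word commutes with every `D_j` iff
it «contain[s] an even number of the set `{b_j^x, b_j^y, b_j^z, c_j}`» for every `j`.
[cite: BravyiTerhalLeemhuis2010, §5 Lemma 1, proof (arXiv:1004.3791 chunk p0009 L15–16)] -/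
def btlParity (n : ℕ) : (Fin (n * 4) → ZMod 2) →ₗ[ZMod 2] (Fin n → ZMod 2) where
  toFun u j := ∑ t : Fin 4, u (finProdFinEquiv (j, t))
  map_add' u v := by
    ext j
    simp [Finset.sum_add_distrib]
  map_smul' c u := by
    ext j
    simp [Finset.mul_sum]

/-- Unfolding of `btlParity`. [cite: BravyiTerhalLeemhuis2010, §5 Lemma 1, proof (arXiv:1004.3791 chunk p0009 L15–16)] -/
theorem btlParity_apply (u : Fin (n * 4) → ZMod 2) (j : Fin n) :
    btlParity n u j = ∑ t : Fin 4, u (finProdFinEquiv (j, t)) := rfl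

/-- **Back to Paulis.** An even word on block `j`, `(p, q, r, s)` with `p+q+r+s = 0`, is (modulo `D_j`)
the support of a unique Pauli: `(a_j | b_j) = (p + q | q + r)` («it must contain an even number of the
set `{b_j^x, b_j^y, b_j^z, c_j}`, and therefore it corresponds to a logical operator of `S`»). This
linear map is a left inverse of `btlLift` killing the `D_j`.
[cite: BravyiTerhalLeemhuis2010, §5 Lemma 1, proof (arXiv:1004.3791 chunk p0009 L15–16)] -/
def btlProj (n : ℕ) : (Fin (n * 4) → ZMod 2) →ₗ[ZMod 2] SympVec n where
  toFun u :=
    (fun j => u (finProdFinEquiv (j, 0)) + u (finProdFinEquiv (j, 1)),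
      fun j => u (finProdFinEquiv (j, 1)) + u (finProdFinEquiv (j, 2)))
  map_add' u v := by
    ext j
    · simp only [Pi.add_apply, Prod.fst_add]; ring
    · simp only [Pi.add_apply, Prod.snd_add]; ring
  map_smul' c u := by
    ext j
    · simp only [Pi.smul_apply, smul_eq_mul, Prod.smul_fst, RingHom.id_apply]; ring
    · simp only [Pi.smul_apply, smul_eq_mul, Prod.smul_snd, RingHom.id_apply]; ring

/-- `a`-part of `btlProj`. [cite: BravyiTerhalLeemhuis2010, §5 Lemma 1, proof (arXiv:1004.3791 chunk p0009 L15–16)] -/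
theorem btlProj_fst (u : Fin (n * 4) → ZMod 2) (j : Fin n) :
    (btlProj n u).1 j = u (finProdFinEquiv (j, 0)) + u (finProdFinEquiv (j, 1)) := rfl

/-- `b`-part of `btlProj`. [cite: BravyiTerhalLeemhuis2010, §5 Lemma 1, proof (arXiv:1004.3791 chunk p0009 L15–16)] -/
theorem btlProj_snd (u : Fin (n * 4) → ZMod 2) (j : Fin n) :
    (btlProj n u).2 j = u (finProdFinEquiv (j, 1)) + u (finProdFinEquiv (j, 2)) := rfl

/-- A sum over the `4n` modes is a sum over qubits `j` and local modes `t`. [folklore] -/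
private theorem sum_modes {M : Type*} [AddCommMonoid M] (f : Fin (n * 4) → M) :
    ∑ i, f i = ∑ j : Fin n, ∑ t : Fin 4, f (finProdFinEquiv (j, t)) := by
  rw [← Fintype.sum_prod_type (f := fun p : Fin n × Fin 4 => f (finProdFinEquiv p))]
  exact (Fintype.sum_equiv finProdFinEquiv _ _ fun p => rfl).symm

/-! #### Block truth tables (decided by the kernel over `𝔽₂`) -/

/-- Block `j` of `btlLift s ⬝ᵥ btlLift t` is `a_j b'_j + a'_j b_j`. [folklore] -/
private theorem blk_lift_mul_lift : ∀ a b a' b' : ZMod 2,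
    ∑ t : Fin 4, (btlXCoeff t * a + btlZCoeff t * b) * (btlXCoeff t * a' + btlZCoeff t * b') =
      a * b' + a' * b := by
  decide

/-- Block `j` of `btlLift s` is even. [folklore] -/
private theorem blk_lift_parity : ∀ a b : ZMod 2,
    ∑ t : Fin 4, (btlXCoeff t * a + btlZCoeff t * b) = 0 := by
  decide

/-- Block `j` of `u ⬝ᵥ btlLift t`. [folklore] -/
private theorem blk_dot_lift : ∀ u0 u1 u2 u3 a b : ZMod 2,
    u0 * (btlXCoeff 0 * a + btlZCoeff 0 * b) + u1 * (btlXCoeff 1 * a + btlZCoeff 1 * b) +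
        u2 * (btlXCoeff 2 * a + btlZCoeff 2 * b) + u3 * (btlXCoeff 3 * a + btlZCoeff 3 * b) =
      (u0 + u1) * b + a * (u1 + u2) + (u0 + u1 + u2 + u3) * (a + b) := by
  decide

/-- Block `j` of `btlLift s` has weight `2` if `(a_j, b_j) ≠ 0` («every Pauli operator corresponds
to a weight-2 Majorana operator»). [folklore] -/
private theorem blk_lift_weight : ∀ a b : ZMod 2,
    ∑ t : Fin 4, (if btlXCoeff t * a + btlZCoeff t * b ≠ 0 then 1 else 0) =
      2 * (if a ≠ 0 ∨ b ≠ 0 then 1 else 0) := by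
  decide

/-- A nonzero even block has weight `≥ 2`. [folklore] -/
private theorem blk_even_weight : ∀ u0 u1 u2 u3 : ZMod 2, u0 + u1 + u2 + u3 = 0 →
    2 * (if u0 + u1 ≠ 0 ∨ u1 + u2 ≠ 0 then 1 else 0) ≤
      (if u0 ≠ 0 then 1 else 0) + (if u1 ≠ 0 then 1 else 0) + (if u2 ≠ 0 then 1 else 0) +
        (if u3 ≠ 0 then 1 else 0) := by
  decide

/-- An even block with trivial Pauli projection is a multiple of `1111`. [folklore] -/
private theorem blk_const : ∀ p q r s : ZMod 2, p + q = 0 → q + r = 0 → p + q + r + s = 0 →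
    q = p ∧ r = p ∧ s = p := by
  decide

/-! #### The identities of the construction -/

/-- `btlProj ∘ btlLift = id`: the Pauli is recovered from its support.
[cite: BravyiTerhalLeemhuis2010, §5 Lemma 1, proof (arXiv:1004.3791 chunk p0009 L14–16)] -/
theorem btlProj_btlLift (s : SympVec n) : btlProj n (btlLift n s) = s := by
  ext j
  · simp only [btlProj_fst, btlLift_apply, btlXCoeff_zero, btlZCoeff_zero, btlXCoeff_one,
      btlZCoeff_one, one_mul, zero_mul, add_zero]
  · simp only [btlProj_snd, btlLift_apply, btlXCoeff_one, btlZCoeff_one, btlXCoeff_two,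
      btlZCoeff_two, one_mul, zero_mul, zero_add]

/-- `btlProj D_j = 0`. [cite: BravyiTerhalLeemhuis2010, §5 Lemma 1, proof (arXiv:1004.3791 chunk p0009 L14–16)] -/
theorem btlProj_btlGauge (j : Fin n) : btlProj n (btlGauge j) = 0 := by
  ext j'
  · simp only [btlProj_fst, btlGauge_apply, Prod.fst_zero, Pi.zero_apply]
    exact zmod2_add_self _
  · simp only [btlProj_snd, btlGauge_apply, Prod.snd_zero, Pi.zero_apply]
    exact zmod2_add_self _

/-- The images `btlLift s` are even on every block (they commute with every `D_j`).
[cite: BravyiTerhalLeemhuis2010, §5 Lemma 1, proof (arXiv:1004.3791 chunk p0009 L14–18)] -/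
theorem btlParity_btlLift (s : SympVec n) : btlParity n (btlLift n s) = 0 := by
  funext j
  simp only [btlParity_apply, btlLift_apply, Pi.zero_apply]
  exact blk_lift_parity _ _

/-- `D_j` is even on every block. [cite: BravyiTerhalLeemhuis2010, §5 Lemma 1, proof (arXiv:1004.3791 chunk p0009 L14–18)] -/
theorem btlParity_btlGauge (j : Fin n) : btlParity n (btlGauge j) = 0 := by
  funext j'
  simp only [btlParity_apply, btlGauge_apply, Pi.zero_apply, Finset.sum_const, Finset.card_univ,
    Fintype.card_fin]
  split_ifs <;> decide

/-- `D_j ⬝ᵥ u` is the parity of `u` on block `j`.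
[cite: BravyiTerhalLeemhuis2010, §5 Lemma 1, proof (arXiv:1004.3791 chunk p0009 L15–16)] -/
theorem btlGauge_dotProduct (j : Fin n) (u : Fin (n * 4) → ZMod 2) :
    btlGauge j ⬝ᵥ u = btlParity n u j := by
  rw [dotProduct, sum_modes, btlParity_apply]
  simp only [btlGauge_apply, ite_mul, one_mul, zero_mul, Finset.sum_ite_irrel,
    Finset.sum_const_zero, Finset.sum_ite_eq', Finset.mem_univ, if_true]

/-- **Products become symplectic inner products:** `btlLift s ⬝ᵥ btlLift t = ⟨s, t⟩`, i.e. the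
Majorana images of two Paulis have even overlap iff the Paulis commute.
[cite: BravyiTerhalLeemhuis2010, §5 Lemma 1, proof (arXiv:1004.3791 chunk p0009 L11–14)] -/
theorem btlLift_dotProduct_btlLift (s t : SympVec n) :
    btlLift n s ⬝ᵥ btlLift n t = sympInner s t := by
  rw [dotProduct, sum_modes, sympInner, dotProduct, dotProduct, ← Finset.sum_add_distrib]
  refine Finset.sum_congr rfl fun j _ => ?_
  simp only [btlLift_apply]
  exact blk_lift_mul_lift _ _ _ _

/-- Overlap of an arbitrary word `u` with `btlLift t`: `⟨btlProj u, t⟩` plus a correction supported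
on the odd blocks of `u`. [cite: BravyiTerhalLeemhuis2010, §5 Lemma 1, proof (arXiv:1004.3791 chunk p0009 L15–16)] -/
theorem dotProduct_btlLift (u : Fin (n * 4) → ZMod 2) (t : SympVec n) :
    u ⬝ᵥ btlLift n t = sympInner (btlProj n u) t + ∑ j, btlParity n u j * (t.1 j + t.2 j) := by
  rw [dotProduct, sum_modes, sympInner, dotProduct, dotProduct, ← Finset.sum_add_distrib,
    ← Finset.sum_add_distrib]
  refine Finset.sum_congr rfl fun j _ => ?_
  simp only [btlLift_apply, btlProj_fst, btlProj_snd, btlParity_apply, Fin.sum_univ_four]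
  exact blk_dot_lift _ _ _ _ _ _

/-- **Weights double:** `wt(btlLift s) = 2 · wt(s)` («every Pauli operator corresponds to a weight-2
Majorana operator»). [cite: BravyiTerhalLeemhuis2010, §5 Lemma 1, proof (arXiv:1004.3791 chunk p0009 L16)] -/
theorem hammingNorm_btlLift (s : SympVec n) : hammingNorm (btlLift n s) = 2 * sympWeight s := by
  simp only [hammingNorm, sympWeight, Finset.card_filter]
  rw [sum_modes, Finset.mul_sum]
  refine Finset.sum_congr rfl fun j _ => ?_
  simp only [btlLift_apply]
  exact blk_lift_weight _ _

/-- A word that is even on every block has weight at least twice the weight of its Pauli projection.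
[cite: BravyiTerhalLeemhuis2010, §5 Lemma 1, proof (arXiv:1004.3791 chunk p0009 L15–16)] -/
theorem two_mul_sympWeight_btlProj_le (u : Fin (n * 4) → ZMod 2) (hu : btlParity n u = 0) :
    2 * sympWeight (btlProj n u) ≤ hammingNorm u := by
  simp only [hammingNorm, sympWeight, Finset.card_filter]
  rw [sum_modes (fun i => if u i ≠ 0 then 1 else 0), Finset.mul_sum]
  refine Finset.sum_le_sum fun j _ => ?_
  have hj := congr_fun hu j
  rw [btlParity_apply, Fin.sum_univ_four, Pi.zero_apply] at hj
  simp only [btlProj_fst, btlProj_snd, Fin.sum_univ_four]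
  exact blk_even_weight _ _ _ _ hj

/-- `btlLift s ∈ btlCode S` for `s ∈ S`. [cite: BravyiTerhalLeemhuis2010, §5 Lemma 1, proof (arXiv:1004.3791 chunk p0009 L11–14)] -/
theorem btlLift_mem_btlCode {S : Submodule (ZMod 2) (SympVec n)} {s : SympVec n} (hs : s ∈ S) :
    btlLift n s ∈ btlCode S :=
  Submodule.mem_sup_left (Submodule.mem_map_of_mem hs)

/-- `D_j ∈ btlCode S`. [cite: BravyiTerhalLeemhuis2010, §5 Lemma 1, proof (arXiv:1004.3791 chunk p0009 L13–14)] -/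
theorem btlGauge_mem_btlCode (S : Submodule (ZMod 2) (SympVec n)) (j : Fin n) :
    btlGauge j ∈ btlCode S :=
  Submodule.mem_sup_right (Submodule.subset_span ⟨j, rfl⟩)

/-- The gauge span is killed by `btlProj`. [cite: BravyiTerhalLeemhuis2010, §5 Lemma 1, proof (arXiv:1004.3791 chunk p0009 L14–16)] -/
theorem btlProj_eq_zero_of_mem_span {z : Fin (n * 4) → ZMod 2}
    (hz : z ∈ Submodule.span (ZMod 2) (Set.range (btlGauge (n := n)))) : btlProj n z = 0 := by
  have h : Submodule.span (ZMod 2) (Set.range (btlGauge (n := n))) ≤ LinearMap.ker (btlProj n) :=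
    Submodule.span_le.2 (by rintro _ ⟨j, rfl⟩; exact LinearMap.mem_ker.2 (btlProj_btlGauge j))
  exact LinearMap.mem_ker.1 (h hz)

/-- The gauge span is even on every block. [cite: BravyiTerhalLeemhuis2010, §5 Lemma 1, proof (arXiv:1004.3791 chunk p0009 L14–16)] -/
theorem btlParity_eq_zero_of_mem_span {z : Fin (n * 4) → ZMod 2}
    (hz : z ∈ Submodule.span (ZMod 2) (Set.range (btlGauge (n := n)))) : btlParity n z = 0 := by
  have h : Submodule.span (ZMod 2) (Set.range (btlGauge (n := n))) ≤ LinearMap.ker (btlParity n) :=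
    Submodule.span_le.2 (by rintro _ ⟨j, rfl⟩; exact LinearMap.mem_ker.2 (btlParity_btlGauge j))
  exact LinearMap.mem_ker.1 (h hz)

/-- A word orthogonal to every `D_j` is orthogonal to the gauge span. [folklore] -/
private theorem dotProduct_eq_zero_of_mem_span {z u : Fin (n * 4) → ZMod 2}
    (hz : z ∈ Submodule.span (ZMod 2) (Set.range (btlGauge (n := n)))) (hu : btlParity n u = 0) :
    z ⬝ᵥ u = 0 := by
  induction hz using Submodule.span_induction with
  | mem x hx =>
    obtain ⟨j, rfl⟩ := hx
    rw [btlGauge_dotProduct, hu, Pi.zero_apply]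
  | zero => exact zero_dotProduct u
  | add x y _ _ hx hy => rw [add_dotProduct, hx, hy, add_zero]
  | smul a x _ hx => rw [smul_dotProduct, hx, smul_zero]

/-- An even-block word with trivial Pauli projection is a sum of gauge words `D_j`.
[cite: BravyiTerhalLeemhuis2010, §5 Lemma 1, proof (arXiv:1004.3791 chunk p0009 L14–16)] -/
theorem mem_span_btlGauge {v : Fin (n * 4) → ZMod 2} (hP : btlProj n v = 0)
    (hpar : btlParity n v = 0) :
    v ∈ Submodule.span (ZMod 2) (Set.range (btlGauge (n := n))) := by
  have hv : v = ∑ j, v (finProdFinEquiv (j, 0)) • btlGauge j := by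
    funext i
    obtain ⟨⟨j, t⟩, rfl⟩ := finProdFinEquiv.surjective i
    simp only [Finset.sum_apply, Pi.smul_apply, btlGauge_apply, smul_eq_mul, mul_ite, mul_one,
      mul_zero, Finset.sum_ite_eq, Finset.mem_univ, if_true]
    have h1 := congrArg (fun w : SympVec n => w.1 j) hP
    have h2 := congrArg (fun w : SympVec n => w.2 j) hP
    have h3 := congr_fun hpar j
    simp only [btlProj_fst, btlProj_snd, Prod.fst_zero, Prod.snd_zero, Pi.zero_apply,
      btlParity_apply, Fin.sum_univ_four] at h1 h2 h3
    obtain ⟨hq, hr, hs⟩ := blk_const _ _ _ _ h1 h2 h3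
    fin_cases t
    · rfl
    · exact hq
    · exact hr
    · exact hs
  rw [hv]
  exact Submodule.sum_mem _ fun j _ => Submodule.smul_mem _ _ (Submodule.subset_span ⟨j, rfl⟩)

/-- **Membership in the Majorana code:** `u ∈ φ(S_maj)` iff `u` is even on every block and its Pauli
projection is a stabilizer word. [cite: BravyiTerhalLeemhuis2010, §5 Lemma 1, proof (arXiv:1004.3791 chunk p0009 L11–16)] -/
theorem mem_btlCode_iff {S : Submodule (ZMod 2) (SympVec n)} {u : Fin (n * 4) → ZMod 2} :
    u ∈ btlCode S ↔ btlParity n u = 0 ∧ btlProj n u ∈ S := by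
  constructor
  · intro hu
    obtain ⟨y, hy, z, hz, rfl⟩ := Submodule.mem_sup.1 hu
    obtain ⟨s, hs, rfl⟩ := Submodule.mem_map.1 hy
    refine ⟨?_, ?_⟩
    · rw [map_add, btlParity_btlLift, btlParity_eq_zero_of_mem_span hz, add_zero]
    · rw [map_add, btlProj_btlLift, btlProj_eq_zero_of_mem_span hz, add_zero]
      exact hs
  · rintro ⟨hpar, hP⟩
    have hv : u - btlLift n (btlProj n u) ∈ Submodule.span (ZMod 2) (Set.range (btlGauge (n := n))) :=
      mem_span_btlGauge (by rw [map_sub, btlProj_btlLift, sub_self])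
        (by rw [map_sub, btlParity_btlLift, sub_zero, hpar])
    exact Submodule.mem_sup.2 ⟨_, Submodule.mem_map_of_mem hP, _, hv, add_sub_cancel _ _⟩

/-- **Membership in the centralizer:** `u ∈ φ(S_maj)⊥` iff `u` «commute[s] with each `D_j`» (is even
on every block) and its Pauli projection lies in the normaliser `S̄⊥` («and therefore it corresponds
to a logical operator of `S`»). [cite: BravyiTerhalLeemhuis2010, §5 Lemma 1, proof (arXiv:1004.3791 chunk p0009 L15–16)] -/
theorem mem_dualCode_btlCode_iff {S : Submodule (ZMod 2) (SympVec n)} {u : Fin (n * 4) → ZMod 2} :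
    u ∈ dualCode (btlCode S) ↔ btlParity n u = 0 ∧ btlProj n u ∈ sympDual S := by
  rw [mem_dualCode_iff]
  constructor
  · intro h
    have hpar : btlParity n u = 0 := by
      funext j
      rw [Pi.zero_apply, ← btlGauge_dotProduct]
      exact h _ (btlGauge_mem_btlCode S j)
    refine ⟨hpar, mem_sympDual_iff.2 fun t ht => ?_⟩
    have h1 := h _ (btlLift_mem_btlCode ht)
    rw [dotProduct_comm, dotProduct_btlLift, hpar] at h1
    simpa [sympInner_comm] using h1
  · rintro ⟨hpar, hP⟩ c hc
    obtain ⟨y, hy, z, hz, rfl⟩ := Submodule.mem_sup.1 hc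
    obtain ⟨t, ht, rfl⟩ := Submodule.mem_map.1 hy
    have h1 : sympInner (btlProj n u) t = 0 := by
      rw [sympInner_comm]
      exact mem_sympDual_iff.1 hP t ht
    rw [add_dotProduct, dotProduct_comm (btlLift n t), dotProduct_btlLift, hpar, h1,
      dotProduct_eq_zero_of_mem_span hz hpar]
    simp

/-- For `w ∈ Ē`: `btlLift w` is a stabilizer word of the Majorana code iff `w ∈ S̄`.
[cite: BravyiTerhalLeemhuis2010, §5 Lemma 1, proof (arXiv:1004.3791 chunk p0009 L14–16)] -/
theorem btlLift_mem_btlCode_iff {S : Submodule (ZMod 2) (SympVec n)} {w : SympVec n} :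
    btlLift n w ∈ btlCode S ↔ w ∈ S := by
  rw [mem_btlCode_iff, btlParity_btlLift, btlProj_btlLift]
  simp

/-- For `w ∈ Ē`: `btlLift w` is in the centralizer iff `w ∈ S̄⊥` («each logical operator of the
stabilizer code corresponds to a logical operator of the Majorana code»).
[cite: BravyiTerhalLeemhuis2010, §5 Lemma 1, proof (arXiv:1004.3791 chunk p0009 L14–15)] -/
theorem btlLift_mem_dualCode_btlCode_iff {S : Submodule (ZMod 2) (SympVec n)} {w : SympVec n} :
    btlLift n w ∈ dualCode (btlCode S) ↔ w ∈ sympDual S := by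
  rw [mem_dualCode_btlCode_iff, btlParity_btlLift, btlProj_btlLift]
  simp

/-- An abelian stabilizer gives an abelian, even Majorana group: `φ(S_maj) ⊆ φ(S_maj)⊥`.
[cite: BravyiTerhalLeemhuis2010, §5 Lemma 1, proof (arXiv:1004.3791 chunk p0009 L11–18)] -/
theorem btlCode_le_dualCode {S : Submodule (ZMod 2) (SympVec n)} (hS : IsSelfOrthogonal S) :
    btlCode S ≤ dualCode (btlCode S) := fun u hu => by
  rw [mem_btlCode_iff] at hu
  exact mem_dualCode_btlCode_iff.2 ⟨hu.1, hS hu.2⟩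

/-- `btlLift` is injective (it has the left inverse `btlProj`). [cite: BravyiTerhalLeemhuis2010, §5 Lemma 1, proof (arXiv:1004.3791 chunk p0009 L11–14)] -/
theorem btlLift_injective (n : ℕ) : Function.Injective (btlLift n) :=
  Function.LeftInverse.injective (g := btlProj n) fun s => btlProj_btlLift s

/-- The gauge words `D_1, …, D_n` are linearly independent (disjoint supports).
[cite: BravyiTerhalLeemhuis2010, §5 Lemma 1, proof (arXiv:1004.3791 chunk p0009 L13–14)] -/
theorem linearIndependent_btlGauge (n : ℕ) : LinearIndependent (ZMod 2) (btlGauge (n := n)) := by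
  rw [Fintype.linearIndependent_iff]
  intro g hg j
  have h := congr_fun hg (finProdFinEquiv (j, 0))
  simpa [Finset.sum_apply, btlGauge_apply, Finset.sum_ite_eq, Finset.sum_ite_eq'] using h

/-- **«Thus the Majorana fermion code `S_maj` is generated by `2n − k` independent generators»**:
`dim φ(S_maj) = dim S̄ + n`. [cite: BravyiTerhalLeemhuis2010, §5 Lemma 1, proof (arXiv:1004.3791 chunk p0009 L14)] -/
theorem finrank_btlCode (S : Submodule (ZMod 2) (SympVec n)) :
    finrank (ZMod 2) (btlCode S) = finrank (ZMod 2) S + n := by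
  have hdisj : S.map (btlLift n) ⊓ Submodule.span (ZMod 2) (Set.range (btlGauge (n := n))) = ⊥ := by
    rw [eq_bot_iff]
    intro x hx
    obtain ⟨hx1, hx2⟩ := Submodule.mem_inf.1 hx
    obtain ⟨s, hs, rfl⟩ := Submodule.mem_map.1 hx1
    have h0 : s = 0 := by
      rw [← btlProj_btlLift s]
      exact btlProj_eq_zero_of_mem_span hx2
    rw [h0, map_zero]
    exact Submodule.zero_mem _
  have h := Submodule.finrank_sup_add_finrank_inf_eq (S.map (btlLift n))
    (Submodule.span (ZMod 2) (Set.range (btlGauge (n := n))))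
  rw [hdisj, finrank_bot, add_zero,
    ← LinearEquiv.finrank_eq (Submodule.equivMapOfInjective _ (btlLift_injective n) S),
    finrank_span_eq_card (linearIndependent_btlGauge n), Fintype.card_fin] at h
  exact h

/-- **BTL Lemma 1 (Kitaev's map), binary form.** For an `[[n,k,d]]` additive (stabilizer) code `S̄`,
the code of supports `btlCode S̄ ≤ 𝔽₂^{4n}` is a Majorana fermion code on `4n` modes encoding `k`
logical qubits with distance `2d`.
[cite: BravyiTerhalLeemhuis2010, §5 Lemma 1 (arXiv:1004.3791 chunk p0009 L6–16)] -/
theorem BravyiTerhalLeemhuis2010_lemma1 {S : Submodule (ZMod 2) (SympVec n)} {k d : ℕ}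
    (hS : IsAdditiveCode S k d) : IsMajoranaCode (btlCode S) k (2 * d) := by
  obtain ⟨hso, hdim, hmin, -⟩ := hS
  refine ⟨btlCode_le_dualCode hso, ?_, fun u hu huC => ?_⟩
  · rw [finrank_btlCode]
    omega
  · obtain ⟨hpar, hP⟩ := mem_dualCode_btlCode_iff.1 hu
    have hPS : btlProj n u ∉ S := fun h => huC (mem_btlCode_iff.2 ⟨hpar, h⟩)
    calc 2 * d ≤ 2 * sympWeight (btlProj n u) := Nat.mul_le_mul_left 2 (hmin _ hP hPS)
      _ ≤ hammingNorm u := two_mul_sympWeight_btlProj_le u hpar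

/-- **The distance is exactly doubled:** the weakly self-dual CSS code of `btlCode S̄` has no logical
of weight `< e` iff `S̄⊥ ∖ S̄` has no word `w` with `2·wt(w) < e` (the words `btlLift w`,
`w ∈ S̄⊥ ∖ S̄`, are logicals of weight exactly `2·wt(w)`).
[cite: BravyiTerhalLeemhuis2010, §5 Lemma 1, proof (arXiv:1004.3791 chunk p0009 L14–16) and Lemma 2, proof (L64–70)] -/
theorem hasMinDist_btl_iff {S : Submodule (ZMod 2) (SympVec n)} (hS : IsSelfOrthogonal S) (e : ℕ) :
    HasMinDist (cssSpace (btlCode S) (dualCode (btlCode S))) e ↔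
      ∀ w ∈ sympDual S, w ∉ S → e ≤ 2 * sympWeight w := by
  rw [hasMinDist_cssSpace_dualCode_iff (btlCode_le_dualCode hS)]
  constructor
  · intro h w hw hwS
    rw [← hammingNorm_btlLift]
    exact h _ (btlLift_mem_dualCode_btlCode_iff.2 hw) fun h' => hwS (btlLift_mem_btlCode_iff.1 h')
  · intro h u hu huC
    obtain ⟨hpar, hP⟩ := mem_dualCode_btlCode_iff.1 hu
    exact (h _ hP fun h' => huC (mem_btlCode_iff.2 ⟨hpar, h'⟩)).trans
      (two_mul_sympWeight_btlProj_le u hpar)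

/-- **BTL Corollary 1.** Any `[[n,k,d]]` additive (stabilizer) code `S̄` with `k ≥ 1` is mapped to the
weakly self-dual CSS code `cssSpace (btlCode S̄) (btlCode S̄)⊥ = btlCode S̄ × btlCode S̄` on `4n`
qubits, which is a `[[4n, 2k, 2d]]` additive code.
[cite: BravyiTerhalLeemhuis2010, §5 Corollary 1 (arXiv:1004.3791 chunk p0009 L74–76)] -/
theorem BravyiTerhalLeemhuis2010_corollary1 {S : Submodule (ZMod 2) (SympVec n)} {k d : ℕ}
    (hS : IsAdditiveCode S k d) (hk : 0 < k) :
    IsAdditiveCode (cssSpace (btlCode S) (dualCode (btlCode S))) (2 * k) (2 * d) :=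
  BravyiTerhalLeemhuis2010_lemma2 (BravyiTerhalLeemhuis2010_lemma1 hS) hk

/-- **BTL Corollary 1, existence form:** an `[[n,k,d]]` additive code with `k ≥ 1` gives a
`[[4n, 2k, 2d]]` additive code. [cite: BravyiTerhalLeemhuis2010, §5 Corollary 1 (arXiv:1004.3791 chunk p0009 L74–76)] -/
theorem BravyiTerhalLeemhuis2010_corollary1_exists {n k d : ℕ} (h : AdditiveCodeExists n k d)
    (hk : 0 < k) : AdditiveCodeExists (4 * n) (2 * k) (2 * d) := by
  obtain ⟨S, hS⟩ := h
  rw [Nat.mul_comm 4 n]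
  exact ⟨_, BravyiTerhalLeemhuis2010_corollary1 hS hk⟩

end Lemma1

end Literature.InformationTheory.QuantumCodes
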